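import Mathlib.Algebra.Field.ZMod
import Mathlib.Tactic.LinearCombination
import Mathlib.Tactic.Linarith
import Mathlib.Tactic.Ring
import Mathlib.Tactic.NormNum
import HarnessLib

/-!
# Bhargava–Skinner–Zhang, proof of Lemma 18: the residue count is `2(p-1)²`, not `(2p-1)(p-1)`
# (proved for every prime `p ≥ 5` and every `k ≥ 1`)

`Proofs` companion of `Literature/NumberTheory/EllipticCurves/LeadingTerm.lean` (bsd.S27,
`Literature.NumberTheory.EllipticCurves.bhargava_skinner_zhang`; see the caveat in its docstring)
and of the `Certificate` section of `LeadingTermBSZAssemblyProofs` (which checks the count by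
`decide` for `p = 5`, `k ≤ 2`). Source: M. Bhargava, C. Skinner, W. Zhang, *A majority of elliptic
curves over `ℚ` satisfy the Birch and Swinnerton-Dyer conjecture*, arXiv:1407.1826 (2014), proof
of Lemma 18: "given `A` modulo `p^{k+2}` belonging to any one of the `½(p-1)p^{k+1}` primitive
residue classes modulo `p^{k+2}` such that `27B² ≡ -4A³ (mod p)` is solvable, there exist exactly
`(2p-1)(p-1)` residue classes for `B` modulo `p^{k+2}` (depending on `A` modulo `p^{k+2}`) such
that `ord_p(Δ(A,B)) = k` and `Δ(A,B)/p^k ∉ S_k (mod p²)`", `S_k ⊂ ℤ_p^×` "a subset of size `p - 1`".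

This file PROVES the structure of that count for every prime `p ≥ 5`, every `k ≥ 1` and every such
`A` (`Literature.NumberTheory.EllipticCurves.bsz_lemma18_card_residues_eq`): for ANY set `Z` of
residues `z (mod p²)`, the number of `B (mod p^{k+2})` with `4A³ + 27B² ≡ p^k z (mod p^{k+2})` for
some `z ∈ Z` is exactly `2·#Z` — one `B` in each of the two discs `B ≡ ±B₀ (mod p)` for each target,
because `B ↦ 4A³ + 27B²` is injective on each disc modulo `p^{k+2}`
(`(4A³+27B²) - (4A³+27B'²) = 27(B-B')(B+B')` with `27(B+B') ≡ 54B₀` a unit) and the disc and the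
target set `{d ≡ 0 (mod p)}` have the same size. (`Δ(A,B) = -16(4A³+27B²)` differs from `4A³+27B²`
by the unit `-16`, which only relabels `Z`.) With `Z` = the `p(p-1) - (p-1) = (p-1)²` units modulo
`p²` outside `S_k`, the count is therefore `2(p-1)²` (`= 32` for `p = 5`), not the printed
`(2p-1)(p-1)` (`= 36`): the print removes the `p - 1` excluded classes once instead of once per disc.
Consequently `μ₅(Σ₅^spl) = (8/125)(1 - 4/(5⁵-1))(1-5⁻¹⁰)⁻¹` (printed `9/125 …`),
`μ(S₁'(5)) = .78381…` (printed `.7918054`) and Cor 26 yields `65.97%` (printed `66.48%`), as recorded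
in `LeadingTerm.lean` and `LeadingTermBSZAssemblyProofs.lean`
(`bhargava_skinner_zhang_corrected_of_pieces`, `bsz_cor26_corrected_value`).

## References

* M. Bhargava, C. Skinner, W. Zhang, arXiv:1407.1826 (2014), Lemma 18 and its proof.
  [cite: BhargavaSkinnerZhang2014, Lemma 18 (proof, the residue count)]
-/

namespace Literature.NumberTheory.EllipticCurves

namespace BSZLemma18

variable {p : ℕ} [hp : Fact p.Prime]

/-! ### Units and reduction modulo `p` in `ZMod (p ^ n)` -/

/-- In `ZMod (p^n)`, `n ≥ 1`, an element whose reduction modulo `p` is nonzero is a unit. [folklore] -/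
theorem isUnit_of_castHom_ne_zero {n : ℕ} (hn : 0 < n) (h : p ∣ p ^ n) (x : ZMod (p ^ n))
    (hx : ZMod.castHom h (ZMod p) x ≠ 0) : IsUnit x := by
  haveI : NeZero (p ^ n) := ⟨pow_ne_zero n hp.out.ne_zero⟩
  rw [← ZMod.natCast_zmod_val x] at hx ⊢
  rw [ZMod.isUnit_natCast_iff_not_dvd_pow hp.out hn]
  rw [map_natCast, ne_eq, ZMod.natCast_eq_zero_iff] at hx
  exact hx

/-- `27` is nonzero modulo a prime `p ≥ 5`. [folklore] -/
theorem twentyseven_ne_zero_zmod (hp5 : 5 ≤ p) : (27 : ZMod p) ≠ 0 := by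
  intro h
  have h' : ((27 : ℕ) : ZMod p) = 0 := by exact_mod_cast h
  rw [ZMod.natCast_eq_zero_iff] at h'
  have h3 : p ∣ 3 := hp.out.dvd_of_dvd_pow (show p ∣ 3 ^ 3 by norm_num; exact h')
  have := Nat.le_of_dvd (by norm_num) h3
  omega

/-- `2` is nonzero modulo any `q ≥ 5`. [folklore] -/
theorem two_ne_zero_zmod {q : ℕ} (hp5 : 5 ≤ q) : (2 : ZMod q) ≠ 0 := by
  intro h
  have h' : ((2 : ℕ) : ZMod q) = 0 := by exact_mod_cast h
  rw [ZMod.natCast_eq_zero_iff] at h'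
  have := Nat.le_of_dvd (by norm_num) h'
  omega

/-- All fibres of the reduction `ZMod (p^n) → ZMod p` have the same size (translation by a lift).
[folklore] -/
theorem card_filter_castHom_eq {n : ℕ} (h : p ∣ p ^ n) (b : ZMod p) :
    (Finset.univ.filter (fun B : ZMod (p ^ n) ↦ ZMod.castHom h (ZMod p) B = b)).card =
      (Finset.univ.filter (fun B : ZMod (p ^ n) ↦ ZMod.castHom h (ZMod p) B = 0)).card := by
  haveI : NeZero (p ^ n) := ⟨pow_ne_zero n hp.out.ne_zero⟩
  obtain ⟨t, ht⟩ := ZMod.ringHom_surjective (ZMod.castHom h (ZMod p)) b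
  have key : Finset.univ.filter (fun B : ZMod (p ^ n) ↦ ZMod.castHom h (ZMod p) B = b) =
      (Finset.univ.filter (fun B : ZMod (p ^ n) ↦ ZMod.castHom h (ZMod p) B = 0)).map
        (Equiv.addRight t).toEmbedding := by
    ext B
    simp only [Finset.mem_filter, Finset.mem_univ, true_and, Finset.mem_map,
      Equiv.coe_toEmbedding, Equiv.coe_addRight]
    constructor
    · intro hB
      refine ⟨B - t, ?_, sub_add_cancel B t⟩
      rw [map_sub, hB, ht, sub_self]
    · rintro ⟨B₀, h0, rfl⟩
      rw [map_add, h0, ht, zero_add]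
  rw [key, Finset.card_map]

/-! ### The map `B ↦ 4A³ + 27B²` on a disc `B ≡ B₀ (mod p)` -/

/-- **Injectivity on a disc**: for `p ≥ 5`, if `B ≡ B' ≡ B₀ ≢ 0 (mod p)` and
`4A³ + 27B² = 4A³ + 27B'²` in `ZMod (p^n)`, then `B = B'`
(`27(B - B')(B + B') = 0` with `27` and `B + B' ≡ 2B₀` units). [folklore] -/
theorem eq_of_disc_of_eq {n : ℕ} (hn : 0 < n) (h : p ∣ p ^ n) (hp5 : 5 ≤ p) (A : ZMod (p ^ n))
    {b₀ : ZMod p} (hb₀ : b₀ ≠ 0) {B B' : ZMod (p ^ n)}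
    (hB : ZMod.castHom h (ZMod p) B = b₀) (hB' : ZMod.castHom h (ZMod p) B' = b₀)
    (heq : 4 * A ^ 3 + 27 * B ^ 2 = 4 * A ^ 3 + 27 * B' ^ 2) : B = B' := by
  have h27 : IsUnit (27 : ZMod (p ^ n)) := by
    refine isUnit_of_castHom_ne_zero hn h _ ?_
    rw [map_ofNat]
    exact twentyseven_ne_zero_zmod hp5
  have hsum : IsUnit (B + B') := by
    refine isUnit_of_castHom_ne_zero hn h _ ?_
    rw [map_add, hB, hB', ← two_mul]
    exact mul_ne_zero (two_ne_zero_zmod hp5) hb₀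
  have hprod : (27 : ZMod (p ^ n)) * ((B - B') * (B + B')) = 0 := by
    linear_combination heq
  rw [h27.mul_right_eq_zero, hsum.mul_left_eq_zero, sub_eq_zero] at hprod
  exact hprod

/-- **The two discs**: if `4a³ + 27b₀² = 0` in `ZMod p` (`p ≥ 5`, `a = A mod p`) and
`4A³ + 27B² ≡ 0 (mod p)`, then `B ≡ ±b₀ (mod p)`. [folklore] -/
theorem castHom_eq_or_eq_neg {n : ℕ} (h : p ∣ p ^ n) (hp5 : 5 ≤ p) (A : ZMod (p ^ n))
    {b₀ : ZMod p} (hroot : 4 * (ZMod.castHom h (ZMod p) A) ^ 3 + 27 * b₀ ^ 2 = 0)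
    {B : ZMod (p ^ n)} (hB : ZMod.castHom h (ZMod p) (4 * A ^ 3 + 27 * B ^ 2) = 0) :
    ZMod.castHom h (ZMod p) B = b₀ ∨ ZMod.castHom h (ZMod p) B = -b₀ := by
  have hB' : 4 * (ZMod.castHom h (ZMod p) A) ^ 3 + 27 * (ZMod.castHom h (ZMod p) B) ^ 2 = 0 := by
    have := hB
    simp only [map_add, map_mul, map_pow, map_ofNat] at this
    exact this
  have hprod : (27 : ZMod p) * ((ZMod.castHom h (ZMod p) B - b₀) *
      (ZMod.castHom h (ZMod p) B + b₀)) = 0 := by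
    linear_combination hB' - hroot
  rcases mul_eq_zero.mp hprod with h1 | h1
  · exact absurd h1 (twentyseven_ne_zero_zmod hp5)
  rcases mul_eq_zero.mp h1 with h2 | h2
  · exact Or.inl (sub_eq_zero.mp h2)
  · exact Or.inr (eq_neg_of_add_eq_zero_left h2)

/-- **Bijectivity on a disc** (injective between sets of the same size): for `b ≠ 0` with
`4a³ + 27b² = 0`, every `d ≡ 0 (mod p)` in `ZMod (p^n)` is `4A³ + 27B²` for a (unique) `B ≡ b (mod p)`.
[folklore] -/
theorem exists_disc_eq {n : ℕ} (hn : 0 < n) (h : p ∣ p ^ n) (hp5 : 5 ≤ p) (A : ZMod (p ^ n))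
    {b : ZMod p} (hb : b ≠ 0) (hroot : 4 * (ZMod.castHom h (ZMod p) A) ^ 3 + 27 * b ^ 2 = 0)
    {d : ZMod (p ^ n)} (hd : ZMod.castHom h (ZMod p) d = 0) :
    ∃ B : ZMod (p ^ n), ZMod.castHom h (ZMod p) B = b ∧ 4 * A ^ 3 + 27 * B ^ 2 = d := by
  haveI : NeZero (p ^ n) := ⟨pow_ne_zero n hp.out.ne_zero⟩
  set disc := Finset.univ.filter (fun B : ZMod (p ^ n) ↦ ZMod.castHom h (ZMod p) B = b) with hdisc
  set tgt := Finset.univ.filter (fun B : ZMod (p ^ n) ↦ ZMod.castHom h (ZMod p) B = 0) with htgt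
  have hmaps : ∀ B (hB : B ∈ disc), (fun B (_ : B ∈ disc) ↦ 4 * A ^ 3 + 27 * B ^ 2) B hB ∈ tgt := by
    intro B hB
    rw [hdisc, Finset.mem_filter] at hB
    rw [htgt, Finset.mem_filter]
    refine ⟨Finset.mem_univ _, ?_⟩
    simp only [map_add, map_mul, map_pow, map_ofNat, hB.2]
    exact hroot
  have hinj : ∀ B₁ B₂ (h₁ : B₁ ∈ disc) (h₂ : B₂ ∈ disc),
      (fun B (_ : B ∈ disc) ↦ 4 * A ^ 3 + 27 * B ^ 2) B₁ h₁ =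
        (fun B (_ : B ∈ disc) ↦ 4 * A ^ 3 + 27 * B ^ 2) B₂ h₂ → B₁ = B₂ := by
    intro B₁ B₂ h₁ h₂ heq
    rw [hdisc, Finset.mem_filter] at h₁ h₂
    exact eq_of_disc_of_eq hn h hp5 A hb h₁.2 h₂.2 heq
  have hcard : tgt.card ≤ disc.card := (card_filter_castHom_eq h b).symm.le
  have hd' : d ∈ tgt := by
    rw [htgt, Finset.mem_filter]; exact ⟨Finset.mem_univ _, hd⟩
  obtain ⟨B, hB, hBd⟩ := Finset.surj_on_of_inj_on_of_card_le _ hmaps hinj hcard d hd'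
  rw [hdisc, Finset.mem_filter] at hB
  exact ⟨B, hB.2, hBd.symm⟩

/-! ### The targets `p^k z (mod p^{k+2})` -/

/-- The targets `q^k·z (mod q^{k+2})`, `z (mod q²)`, reduce to `0` modulo `q` (`k ≥ 1`). [folklore] -/
theorem castHom_target_eq_zero {q k : ℕ} (hk : 1 ≤ k) (h : q ∣ q ^ (k + 2)) (z : ZMod (q ^ 2)) :
    ZMod.castHom h (ZMod q) ((q : ZMod (q ^ (k + 2))) ^ k * (z.val : ZMod (q ^ (k + 2)))) = 0 := by
  rw [map_mul, map_pow, map_natCast, ZMod.natCast_self, zero_pow (by omega), zero_mul]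

/-- The targets `p^k·z (mod p^{k+2})` are distinct for distinct `z (mod p²)`. [folklore] -/
theorem target_injective (k : ℕ) :
    Function.Injective (fun z : ZMod (p ^ 2) ↦
      (p : ZMod (p ^ (k + 2))) ^ k * (z.val : ZMod (p ^ (k + 2)))) := by
  haveI : NeZero (p ^ 2) := ⟨pow_ne_zero 2 hp.out.ne_zero⟩
  intro z z' hzz
  have hzz' : ((p ^ k * z.val : ℕ) : ZMod (p ^ (k + 2))) = ((p ^ k * z'.val : ℕ) : ZMod (p ^ (k + 2))) := by
    push_cast; exact hzz
  rw [ZMod.natCast_eq_natCast_iff, pow_add] at hzz'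
  have hmod : z.val ≡ z'.val [MOD p ^ 2] :=
    Nat.ModEq.mul_left_cancel' (pow_ne_zero k hp.out.ne_zero) hzz'
  have := (ZMod.natCast_eq_natCast_iff _ _ _).mpr hmod
  rwa [ZMod.natCast_zmod_val, ZMod.natCast_zmod_val] at this

/-! ### The count -/

/-- **Count on one disc**: for `b ≠ 0` with `4a³ + 27b² = 0` and any set `Z` of residues modulo `p²`,
exactly `#Z` classes `B ≡ b (mod p)` modulo `p^{k+2}` have `4A³ + 27B² ≡ p^k z` for some `z ∈ Z`.
[folklore] -/
theorem card_filter_disc_eq {k : ℕ} (hk : 1 ≤ k) (h : p ∣ p ^ (k + 2)) (hp5 : 5 ≤ p)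
    (A : ZMod (p ^ (k + 2))) {b : ZMod p} (hb : b ≠ 0)
    (hroot : 4 * (ZMod.castHom h (ZMod p) A) ^ 3 + 27 * b ^ 2 = 0) (Z : Finset (ZMod (p ^ 2))) :
    (Finset.univ.filter (fun B : ZMod (p ^ (k + 2)) ↦ ZMod.castHom h (ZMod p) B = b ∧
      ∃ z ∈ Z, 4 * A ^ 3 + 27 * B ^ 2 =
        (p : ZMod (p ^ (k + 2))) ^ k * (z.val : ZMod (p ^ (k + 2))))).card = Z.card := by
  have hn : 0 < k + 2 := by omega
  set tg : ZMod (p ^ 2) → ZMod (p ^ (k + 2)) :=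
    fun z ↦ (p : ZMod (p ^ (k + 2))) ^ k * (z.val : ZMod (p ^ (k + 2))) with htg
  set S := Finset.univ.filter (fun B : ZMod (p ^ (k + 2)) ↦ ZMod.castHom h (ZMod p) B = b ∧
      ∃ z ∈ Z, 4 * A ^ 3 + 27 * B ^ 2 = tg z) with hS
  have htginj : Function.Injective tg := target_injective k
  have hZcard : (Z.image tg).card = Z.card := Finset.card_image_of_injective Z htginj
  rw [← hZcard]
  apply le_antisymm
  · -- `B ↦ 4A³ + 27B²` maps `S` injectively into the targets
    refine Finset.card_le_card_of_injOn (fun B ↦ 4 * A ^ 3 + 27 * B ^ 2) ?_ ?_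
    · intro B hB
      have hB' : B ∈ S := hB
      rw [hS, Finset.mem_filter] at hB'
      obtain ⟨_, _, z, hz, hBz⟩ := hB'
      simp only [Finset.coe_image, Set.mem_image, Finset.mem_coe]
      exact ⟨z, hz, hBz.symm⟩
    · intro B₁ h₁ B₂ h₂ heq
      have h₁' : B₁ ∈ S := h₁
      have h₂' : B₂ ∈ S := h₂
      rw [hS, Finset.mem_filter] at h₁' h₂'
      exact eq_of_disc_of_eq hn h hp5 A hb h₁'.2.1 h₂'.2.1 heq
  · -- every target is hit from the disc
    have hsub : Z.image tg ⊆ S.image (fun B ↦ 4 * A ^ 3 + 27 * B ^ 2) := by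
      intro d hd
      rw [Finset.mem_image] at hd
      obtain ⟨z, hz, rfl⟩ := hd
      obtain ⟨B, hBb, hBd⟩ := exists_disc_eq hn h hp5 A hb hroot (castHom_target_eq_zero hk h z)
      rw [Finset.mem_image]
      refine ⟨B, ?_, hBd⟩
      rw [hS, Finset.mem_filter]
      exact ⟨Finset.mem_univ _, hBb, z, hz, hBd⟩
    exact (Finset.card_le_card hsub).trans Finset.card_image_le

end BSZLemma18

open BSZLemma18 in
/-- **The residue count in the proof of Lemma 18 of Bhargava–Skinner–Zhang, corrected and proved.**
Let `p ≥ 5` be prime, `k ≥ 1`, and `A (mod p^{k+2})` with `p ∤ A` such that `27B² ≡ -4A³ (mod p)` is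
solvable. Then for every set `Z` of residues modulo `p²`, the number of residue classes
`B (mod p^{k+2})` with `4A³ + 27B² ≡ p^k·z (mod p^{k+2})` for some `z ∈ Z` is exactly `2·#Z`: the
solutions of `27B² ≡ -4A³ (mod p)` are the two discs `B ≡ ±B₀ (mod p)` (`B₀ ≢ 0`, distinct as `p` is
odd), and on each disc `B ↦ 4A³ + 27B²` is a bijection onto the classes `≡ 0 (mod p)`
(`card_filter_disc_eq`). Since `Δ(A,B) = -16(4A³ + 27B²)` and `-16` is a unit, the same holds for
`Δ(A,B) ≡ p^k·z`. Taking for `Z` the units modulo `p²` outside the source's `S_k` ("a subset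
`S_k ⊂ ℤ_p^×` of size `p - 1`"), `#Z = p(p-1) - (p-1) = (p-1)²`, so the number of classes `B` with
`ord_p(Δ(A,B)) = k` and `Δ(A,B)/p^k ∉ S_k (mod p²)` is `2(p-1)²` — NOT the printed `(2p-1)(p-1)`
(source, proof of Lemma 18: "there exist exactly `(2p-1)(p-1)` residue classes for `B` modulo
`p^{k+2}`"), which removes the `p - 1` excluded classes once instead of once on each disc; for `p = 5`:
`32`, not `36` (cf. the `decide` checks `bsz_lemma18_count_not_mem_S_one/_two` of
`LeadingTermBSZAssemblyProofs`). This is the arithmetic slip behind the printed `μ(S₁'(5)) = .7918…`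
(correct: `.7838…`) and `66.48%` (correct by the printed argument: `65.97%`), see the caveat in the
docstring of `Literature.NumberTheory.EllipticCurves.bhargava_skinner_zhang`.
[cite: BhargavaSkinnerZhang2014, Lemma 18 (proof: the residue count, corrected)] -/
theorem bsz_lemma18_card_residues_eq {p : ℕ} [Fact p.Prime] (hp5 : 5 ≤ p) {k : ℕ} (hk : 1 ≤ k)
    (A : ZMod (p ^ (k + 2)))
    (hA : ZMod.castHom (dvd_pow_self p (Nat.succ_ne_zero (k + 1))) (ZMod p) A ≠ 0)
    (hsol : ∃ b₀ : ZMod p,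
      4 * (ZMod.castHom (dvd_pow_self p (Nat.succ_ne_zero (k + 1))) (ZMod p) A) ^ 3 + 27 * b₀ ^ 2 = 0)
    (Z : Finset (ZMod (p ^ 2))) :
    (Finset.univ.filter (fun B : ZMod (p ^ (k + 2)) ↦ ∃ z ∈ Z,
      4 * A ^ 3 + 27 * B ^ 2 = (p : ZMod (p ^ (k + 2))) ^ k * (z.val : ZMod (p ^ (k + 2))))).card =
      2 * Z.card := by
  set h := (dvd_pow_self p (Nat.succ_ne_zero (k + 1)) : p ∣ p ^ (k + 2)) with hh
  set red := ZMod.castHom h (ZMod p) with hred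
  obtain ⟨b₀, hroot⟩ := hsol
  -- `b₀ ≠ 0` since `4a³ ≠ 0`
  have hb₀ : b₀ ≠ 0 := by
    rintro rfl
    have h4 : (4 : ZMod p) * (red A) ^ 3 = 0 := by
      simpa using hroot
    rcases mul_eq_zero.mp h4 with h4' | h4'
    · have h2 := two_ne_zero_zmod hp5
      have : (4 : ZMod p) = 2 * 2 := by norm_num
      rw [this] at h4'
      exact mul_ne_zero h2 h2 h4'
    · exact hA (pow_eq_zero_iff (by norm_num) |>.mp h4')
  have hroot' : 4 * (red A) ^ 3 + 27 * (-b₀) ^ 2 = 0 := by rw [neg_sq]; exact hroot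
  have hneg : -b₀ ≠ 0 := neg_ne_zero.mpr hb₀
  have hne : b₀ ≠ -b₀ := by
    intro hbb
    have : (2 : ZMod p) * b₀ = 0 := by linear_combination hbb
    exact mul_ne_zero (two_ne_zero_zmod hp5) hb₀ this
  -- split the count over the two discs
  set P : ZMod (p ^ (k + 2)) → Prop := fun B ↦ ∃ z ∈ Z,
      4 * A ^ 3 + 27 * B ^ 2 = (p : ZMod (p ^ (k + 2))) ^ k * (z.val : ZMod (p ^ (k + 2))) with hP
  have hdiscs : ∀ B, P B → red B = b₀ ∨ red B = -b₀ := by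
    rintro B ⟨z, _, hBz⟩
    refine castHom_eq_or_eq_neg h hp5 A hroot ?_
    rw [hBz]
    exact castHom_target_eq_zero hk h z
  have hsplit : Finset.univ.filter P =
      Finset.univ.filter (fun B ↦ red B = b₀ ∧ P B) ∪
        Finset.univ.filter (fun B ↦ red B = -b₀ ∧ P B) := by
    ext B
    simp only [Finset.mem_filter, Finset.mem_univ, true_and, Finset.mem_union]
    constructor
    · intro hB
      rcases hdiscs B hB with h1 | h1
      · exact Or.inl ⟨h1, hB⟩
      · exact Or.inr ⟨h1, hB⟩
    · rintro (⟨_, hB⟩ | ⟨_, hB⟩) <;> exact hB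
  have hdisj : Disjoint (Finset.univ.filter (fun B ↦ red B = b₀ ∧ P B))
      (Finset.univ.filter (fun B ↦ red B = -b₀ ∧ P B)) := by
    rw [Finset.disjoint_filter]
    rintro B _ ⟨h1, _⟩ ⟨h2, _⟩
    exact hne (h1.symm.trans h2)
  rw [hsplit, Finset.card_union_of_disjoint hdisj,
    card_filter_disc_eq hk h hp5 A hb₀ hroot Z, card_filter_disc_eq hk h hp5 A hneg hroot' Z]
  ring

/-- The case `p = 5` of `bsz_lemma18_card_residues_eq` in the numbers of the source: with `#Z = 16`
(the `20` units modulo `25` minus the `4 = p - 1` classes of `S_k`) the count is `32 = 2(p-1)²` for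
every `k ≥ 1` and every admissible `A` — against the printed `(2p-1)(p-1) = 36`. [cite: BhargavaSkinnerZhang2014, Lemma 18 (proof: the residue count, corrected; p = 5)] -/
theorem bsz_lemma18_card_residues_eq_five {k : ℕ} (hk : 1 ≤ k) (A : ZMod (5 ^ (k + 2)))
    (hA : ZMod.castHom (dvd_pow_self 5 (Nat.succ_ne_zero (k + 1))) (ZMod 5) A ≠ 0)
    (hsol : ∃ b₀ : ZMod 5,
      4 * (ZMod.castHom (dvd_pow_self 5 (Nat.succ_ne_zero (k + 1))) (ZMod 5) A) ^ 3 + 27 * b₀ ^ 2 = 0)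
    (Z : Finset (ZMod (5 ^ 2))) (hZ : Z.card = 16) :
    (Finset.univ.filter (fun B : ZMod (5 ^ (k + 2)) ↦ ∃ z ∈ Z,
      4 * A ^ 3 + 27 * B ^ 2 = (5 : ZMod (5 ^ (k + 2))) ^ k * (z.val : ZMod (5 ^ (k + 2))))).card =
      32 := by
  haveI : Fact (Nat.Prime 5) := ⟨Nat.prime_five⟩
  have h := bsz_lemma18_card_residues_eq (p := 5) (le_refl 5) hk A hA hsol Z
  rw [hZ] at h
  simpa using h

end Literature.NumberTheory.EllipticCurves
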